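import Literature.NumberTheory.LFunctions.ZetaPartialSumAtZeros
import Literature.NumberTheory.LFunctions.ZeroSumSobolev
import Literature.NumberTheory.LFunctions.FordZetaZeroRecipSqSum
import HarnessLib

/-!
# `∑_{0 < γ ≤ M} m(ρ) |ζ_M(ρ) ζ_M(1-ρ)| ≪ M`: the zeros below the length

Topic `Literature/NumberTheory/LFunctions`. Companion of
`Literature/NumberTheory/LFunctions/ZetaPartialSumZeroBlocks.lean` for the zeros of `ζ` at
heights BELOW the length `M` of the partial sum `ζ_M(s) = ∑_{k ≤ M} k^{-s}`.  By (4.11.1) at a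
zero `ρ = β + iγ` with `|γ| ≤ 4M` (any real part),
`|ζ_M(ρ)| |ζ_M(1-ρ)| ≤ M/(|ρ||1-ρ|) + 6/|ρ| + 6/|1-ρ| + 36/M`
(`Literature.NumberTheory.LFunctions.norm_zetaPartialSum_mul_le_of_abs_im_le`); summing with
multiplicity over `0 < γ ≤ M` with `∑_ρ m(ρ)/|ρ|² < ∞` (Ford's Lemma 3.3,
`Literature.NumberTheory.LFunctions.sum_zeroOrder_div_norm_sq_le`), `∑_{γ ≤ M} m(ρ)/γ ≪ log² M`
and `N(M) ≪ M log M` (windows of the local count) gives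

* `Literature.NumberTheory.LFunctions.exists_sum_zerosBetween_low_norm_zetaPartialSum_mul_le` —
  `∑_{0 < Im ρ ≤ M} m(ρ) ‖ζ_M(ρ)‖ ‖ζ_M(1-ρ)‖ ≤ C M` for all `M ≥ 1`.

## References

* E. C. Titchmarsh, *The Theory of the Riemann Zeta-Function*, 2nd ed. (1986), Theorem 4.11,
  eq. (4.11.1); Thm. 9.2.
* K. Ford, *Zero-free regions for the Riemann zeta function* (2002), Lemma 3.3.
-/

noncomputable section

open Complex Set Filter Finset
open scoped Real Topology

namespace Literature.NumberTheory.LFunctions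

/-- `∑_{0 < Im ρ ≤ M} m(ρ)/(Im ρ)² ≤ 1/10` (from Ford's `∑ m(ρ)/|ρ|² ≤ 0.0463` and
`|ρ|² ≤ 2 (Im ρ)²`). [cite: Ford2002Millennium, Lemma 3.3] -/
theorem sum_zerosBetween_order_div_im_sq_le (a b : ℝ) (ha : 0 ≤ a) :
    ∑ ρ ∈ SchoenfeldBound.zerosBetween a b, (riemannZetaZeroOrder ρ : ℝ) / ρ.im ^ 2 ≤ 1 / 10 := by
  classical
  set S := SchoenfeldBound.zerosBetween a b with hS
  have hmem : ∀ ρ ∈ S, ρ ∈ RHWave0.riemannZetaNontrivialZeros := fun ρ hρ ↦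
    SchoenfeldBound.mem_nontrivialZeros_of_mem_zerosBetween ha hρ
  rw [← Finset.sum_subtype_of_mem (fun ρ : ℂ ↦ (riemannZetaZeroOrder ρ : ℝ) / ρ.im ^ 2) hmem]
  have h := sum_zeroOrder_div_norm_sq_le (S.subtype (· ∈ RHWave0.riemannZetaNontrivialZeros))
  have hle : ∀ ρ : RHWave0.riemannZetaNontrivialZeros,
      (riemannZetaZeroOrder (ρ : ℂ) : ℝ) / (ρ : ℂ).im ^ 2
        ≤ 2 * ((riemannZetaZeroOrder (ρ : ℂ) : ℝ) / ‖(ρ : ℂ)‖ ^ 2) := by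
    intro ρ
    have hγ := FordL33.fourteen_lt_abs_im ρ
    have hm := (FordL33.order_pos ρ).le
    have hre0 := ZetaZeros.riemannZetaNontrivialZeros.re_pos ρ.2
    have hre1 := ZetaZeros.riemannZetaNontrivialZeros.re_lt_one ρ.2
    have hγ2 : 1 ≤ (ρ : ℂ).im ^ 2 := by
      have : (1 : ℝ) ≤ |(ρ : ℂ).im| := by linarith
      nlinarith [sq_abs (ρ : ℂ).im]
    have hnorm : ‖(ρ : ℂ)‖ ^ 2 ≤ 2 * (ρ : ℂ).im ^ 2 := by
      rw [Complex.sq_norm, Complex.normSq_apply]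
      nlinarith
    have hn0 : 0 < ‖(ρ : ℂ)‖ ^ 2 := by
      have := FordL33.fourteen_lt_norm ρ; positivity
    rw [div_le_iff₀ (by positivity)]
    calc (riemannZetaZeroOrder (ρ : ℂ) : ℝ)
        = (riemannZetaZeroOrder (ρ : ℂ) : ℝ) / ‖(ρ : ℂ)‖ ^ 2 * ‖(ρ : ℂ)‖ ^ 2 := by
          rw [div_mul_cancel₀ _ hn0.ne']
      _ ≤ (riemannZetaZeroOrder (ρ : ℂ) : ℝ) / ‖(ρ : ℂ)‖ ^ 2 * (2 * (ρ : ℂ).im ^ 2) :=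
          mul_le_mul_of_nonneg_left hnorm (div_nonneg hm (sq_nonneg _))
      _ = 2 * ((riemannZetaZeroOrder (ρ : ℂ) : ℝ) / ‖(ρ : ℂ)‖ ^ 2) * (ρ : ℂ).im ^ 2 := by ring
  calc _ ≤ ∑ ρ ∈ S.subtype (· ∈ RHWave0.riemannZetaNontrivialZeros),
        2 * ((riemannZetaZeroOrder (ρ : ℂ) : ℝ) / ‖(ρ : ℂ)‖ ^ 2) := Finset.sum_le_sum fun ρ _ ↦ hle ρ
    _ = 2 * ∑ ρ ∈ S.subtype (· ∈ RHWave0.riemannZetaNontrivialZeros),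
        (riemannZetaZeroOrder (ρ : ℂ) : ℝ) / ‖(ρ : ℂ)‖ ^ 2 := by rw [Finset.mul_sum]
    _ ≤ 2 * 0.0463 := by linarith
    _ ≤ 1 / 10 := by norm_num

/-- `∑_{0 < Im ρ ≤ M} m(ρ)/Im ρ ≤ 2 A₀ log(M+2)(1 + log M)` (windows of the local count).
[cite: Titchmarsh1986, Thm. 9.2] -/
theorem sum_zerosBetween_order_div_im_le {A₀ : ℝ} (hA00 : 0 ≤ A₀)
    (hA₀ : ∀ a : ℝ, 0 ≤ a → (zetaZeroCount (a + 1) : ℝ) - zetaZeroCount a ≤ A₀ * Real.log (a + 2))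
    (M : ℕ) :
    ∑ ρ ∈ SchoenfeldBound.zerosBetween (0 : ℝ) (M : ℝ), (riemannZetaZeroOrder ρ : ℝ) * (1 / ρ.im)
      ≤ A₀ * Real.log (M + 2) * (2 * (1 + Real.log M)) := by
  have hφ : ∀ n ∈ Finset.Ico 0 (0 + M), ∀ ρ ∈ SchoenfeldBound.zerosBetween (n : ℝ) ((n : ℝ) + 1),
      1 / ρ.im ≤ 2 / ((n : ℝ) + 1) := by
    intro n _ ρ hρ
    have hn0 : (0 : ℝ) ≤ n := Nat.cast_nonneg n
    obtain ⟨-, -, -, h3, -⟩ := (SchoenfeldBound.mem_zerosBetween hn0).1 hρ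
    have hmem : ρ ∈ RHWave0.riemannZetaNontrivialZeros :=
      SchoenfeldBound.mem_nontrivialZeros_of_mem_zerosBetween hn0 hρ
    have h14 := FordL33.fourteen_lt_abs_im ⟨ρ, hmem⟩
    simp only at h14
    have hγ : 0 < ρ.im := by linarith
    rw [abs_of_pos hγ] at h14
    rw [div_le_div_iff₀ hγ (by linarith)]
    linarith
  have h := sum_zerosBetween_windows_le (φ := fun ρ : ℂ ↦ 1 / ρ.im) (T := 0)
    (W := fun n ↦ 2 / ((n : ℝ) + 1)) (fun n ↦ by positivity) hA00 hA₀ M hφ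
  simp only [zero_add, Nat.cast_zero] at h
  refine h.trans ?_
  have hW : ∑ n ∈ Finset.Ico 0 M, 2 / ((n : ℝ) + 1) ≤ 2 * (1 + Real.log M) := by
    have e : ∀ N : ℕ, ∑ n ∈ Finset.range N, 2 / ((n : ℝ) + 1) = 2 * ∑ j ∈ Finset.Icc 1 N, 1 / (j : ℝ) := by
      intro N
      induction N with
      | zero => simp
      | succ N ih =>
        rw [Finset.sum_range_succ, Finset.sum_Icc_succ_top (by omega), ih]
        push_cast; ring
    rw [← Finset.range_eq_Ico, e M]
    exact mul_le_mul_of_nonneg_left (Montgomery.sum_Icc_one_div_le_log M) (by norm_num)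
  have hlog : 0 ≤ Real.log ((M : ℝ) + 2) := Real.log_nonneg (by linarith [(Nat.cast_nonneg M : (0:ℝ) ≤ M)])
  exact mul_le_mul_of_nonneg_left hW (mul_nonneg hA00 hlog)

/-- `N(M) = ∑_{0 < Im ρ ≤ M} m(ρ) ≤ A₀ M log(M+2)`. [cite: Titchmarsh1986, Thm. 9.2] -/
theorem sum_zerosBetween_order_le_mul_log {A₀ : ℝ} (hA00 : 0 ≤ A₀)
    (hA₀ : ∀ a : ℝ, 0 ≤ a → (zetaZeroCount (a + 1) : ℝ) - zetaZeroCount a ≤ A₀ * Real.log (a + 2))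
    (M : ℕ) :
    ∑ ρ ∈ SchoenfeldBound.zerosBetween (0 : ℝ) (M : ℝ), (riemannZetaZeroOrder ρ : ℝ)
      ≤ A₀ * Real.log (M + 2) * M := by
  have h := sum_zerosBetween_windows_le (φ := fun _ : ℂ ↦ (1 : ℝ)) (T := 0) (W := fun _ ↦ (1 : ℝ))
    (fun _ ↦ zero_le_one) hA00 hA₀ M (fun _ _ _ _ ↦ le_rfl)
  simp only [zero_add, Nat.cast_zero, mul_one, Finset.sum_const, Nat.card_Ico, tsub_zero,
    nsmul_eq_mul] at h
  simpa using h

/-- **The zeros below the length**: there is an absolute constant `C` with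
`∑_{0 < Im ρ ≤ M} m(ρ) ‖ζ_M(ρ)‖ ‖ζ_M(1-ρ)‖ ≤ C M` for all `M ≥ 1` (zeros of `ζ` with
multiplicity, any real part; `ζ_M(s) = ∑_{k≤M} k^{-s}`).
[cite: Titchmarsh1986, Theorem 4.11, eq. (4.11.1); Thm. 9.2] -/
theorem exists_sum_zerosBetween_low_norm_zetaPartialSum_mul_le :
    ∃ C : ℝ, 0 < C ∧ ∀ M : ℕ, 1 ≤ M →
      ∑ ρ ∈ SchoenfeldBound.zerosBetween (0 : ℝ) (M : ℝ),
          (riemannZetaZeroOrder ρ : ℝ) *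
            (‖∑ k ∈ Finset.Icc 1 M, (k : ℂ) ^ (-ρ)‖ * ‖∑ k ∈ Finset.Icc 1 M, (k : ℂ) ^ (-(1 - ρ))‖)
        ≤ C * M := by
  obtain ⟨A₀, hA₀pos, hA₀⟩ := Montgomery.exists_zetaZeroCount_add_one_sub_le
  have hA00 : 0 ≤ A₀ := hA₀pos.le
  refine ⟨1 / 10 + 264 * A₀, by positivity, fun M hM ↦ ?_⟩
  have hM0 : (0 : ℝ) < M := by exact_mod_cast hM
  have hM1 : (1 : ℝ) ≤ M := by exact_mod_cast hM
  -- pointwise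
  have hpt : ∀ ρ ∈ SchoenfeldBound.zerosBetween (0 : ℝ) (M : ℝ),
      (riemannZetaZeroOrder ρ : ℝ) *
        (‖∑ k ∈ Finset.Icc 1 M, (k : ℂ) ^ (-ρ)‖ * ‖∑ k ∈ Finset.Icc 1 M, (k : ℂ) ^ (-(1 - ρ))‖)
      ≤ M * ((riemannZetaZeroOrder ρ : ℝ) / ρ.im ^ 2)
        + 12 * ((riemannZetaZeroOrder ρ : ℝ) * (1 / ρ.im))
        + 36 / M * (riemannZetaZeroOrder ρ : ℝ) := by
    intro ρ hρ
    obtain ⟨-, -, -, h3, h4⟩ := (SchoenfeldBound.mem_zerosBetween le_rfl).1 hρ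
    have hmem : ρ ∈ ZetaZeros.riemannZetaNontrivialZeros :=
      SchoenfeldBound.mem_nontrivialZeros_of_mem_zerosBetween le_rfl hρ
    have hm : (0 : ℝ) ≤ riemannZetaZeroOrder ρ :=
      SchoenfeldBound.zeroOrder_nonneg_of_mem_zerosBetween le_rfl hρ
    have hγ : |ρ.im| ≤ 4 * M := by rw [abs_of_pos h3]; linarith
    have h := norm_zetaPartialSum_mul_le_of_abs_im_le hmem hM hγ
    -- `‖ρ‖, ‖1-ρ‖ ≥ Im ρ`
    have hρn : ρ.im ≤ ‖ρ‖ := by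
      have := Complex.abs_im_le_norm ρ; rwa [abs_of_pos h3] at this
    have h1ρn : ρ.im ≤ ‖1 - ρ‖ := by
      have := Complex.abs_im_le_norm (1 - ρ)
      simp only [sub_im, one_im, zero_sub, abs_neg] at this
      rwa [abs_of_pos h3] at this
    have hprod : ρ.im ^ 2 ≤ ‖ρ‖ * ‖1 - ρ‖ := by
      rw [sq]; exact mul_le_mul hρn h1ρn h3.le (norm_nonneg _)
    have hbound : M / (‖ρ‖ * ‖1 - ρ‖) + 6 / ‖ρ‖ + 6 / ‖1 - ρ‖ + 36 / M
        ≤ M / ρ.im ^ 2 + 12 * (1 / ρ.im) + 36 / M := by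
      have e1 : (M : ℝ) / (‖ρ‖ * ‖1 - ρ‖) ≤ M / ρ.im ^ 2 :=
        div_le_div_of_nonneg_left hM0.le (by positivity) hprod
      have e2 : 6 / ‖ρ‖ ≤ 6 / ρ.im := div_le_div_of_nonneg_left (by norm_num) h3 hρn
      have e3 : 6 / ‖1 - ρ‖ ≤ 6 / ρ.im := div_le_div_of_nonneg_left (by norm_num) h3 h1ρn
      have : 6 / ρ.im + 6 / ρ.im = 12 * (1 / ρ.im) := by ring
      linarith
    have := mul_le_mul_of_nonneg_left (h.trans hbound) hm
    have e : (riemannZetaZeroOrder ρ : ℝ) * (M / ρ.im ^ 2 + 12 * (1 / ρ.im) + 36 / M)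
        = M * ((riemannZetaZeroOrder ρ : ℝ) / ρ.im ^ 2)
          + 12 * ((riemannZetaZeroOrder ρ : ℝ) * (1 / ρ.im))
          + 36 / M * (riemannZetaZeroOrder ρ : ℝ) := by ring
    linarith
  refine (Finset.sum_le_sum hpt).trans ?_
  rw [Finset.sum_add_distrib, Finset.sum_add_distrib, ← Finset.mul_sum, ← Finset.mul_sum,
    ← Finset.mul_sum]
  have h1 := sum_zerosBetween_order_div_im_sq_le (0 : ℝ) (M : ℝ) le_rfl
  have h2 := sum_zerosBetween_order_div_im_le hA00 hA₀ M
  have h3 := sum_zerosBetween_order_le_mul_log hA00 hA₀ M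
  -- elementary: `log(M+2) ≤ 2M`, `1 + log M ≤ M + 1 ≤ 2M`... all absorbed into `C M`
  have hlogM : Real.log M ≤ (M : ℝ) - 1 := Real.log_le_sub_one_of_pos hM0
  have hlogM2 : Real.log ((M : ℝ) + 2) ≤ (M : ℝ) + 2 - 1 := Real.log_le_sub_one_of_pos (by linarith)
  have hlog0 : 0 ≤ Real.log ((M : ℝ) + 2) := Real.log_nonneg (by linarith)
  have hlogM0 : 0 ≤ Real.log (M : ℝ) := Real.log_nonneg hM1
  have hS2 : 0 ≤ ∑ ρ ∈ SchoenfeldBound.zerosBetween (0 : ℝ) (M : ℝ),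
      (riemannZetaZeroOrder ρ : ℝ) * (1 / ρ.im) := Finset.sum_nonneg fun ρ hρ ↦ by
    obtain ⟨-, -, -, h3, -⟩ := (SchoenfeldBound.mem_zerosBetween le_rfl).1 hρ
    exact mul_nonneg (SchoenfeldBound.zeroOrder_nonneg_of_mem_zerosBetween le_rfl hρ)
      (by positivity)
  have hS3 : 0 ≤ ∑ ρ ∈ SchoenfeldBound.zerosBetween (0 : ℝ) (M : ℝ), (riemannZetaZeroOrder ρ : ℝ) :=
    Finset.sum_nonneg fun ρ hρ ↦ SchoenfeldBound.zeroOrder_nonneg_of_mem_zerosBetween le_rfl hρ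
  -- term 2: `12 * Σ m/γ ≤ 12 A₀ log(M+2) 2 (1 + log M) ≤ 12 A₀ (M+1) 2 (1 + M) ≤ 96 A₀ M²`? we need `≤ C M`:
  -- use `log(M+2) ≤ 3 log M + 2`? simpler: `log(M+2)(1+log M) ≤ (M+1)(1 + log M)`, too big.
  -- Instead bound `log x ≤ √x`-type: `log(M+2) ≤ 2 √(M+2)`? keep it simple with `log y ≤ y/e ≤ y`:
  -- `log(M+2) * (1 + log M) ≤ (M+1) * ... ` is quadratic; so use `log (M+2) ≤ log (3M) ≤ 2 + log M`
  have hlogM2' : Real.log ((M : ℝ) + 2) ≤ 2 + Real.log M := by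
    have : (M : ℝ) + 2 ≤ 3 * M := by linarith
    calc Real.log ((M : ℝ) + 2) ≤ Real.log (3 * M) := Real.log_le_log (by linarith) this
      _ = Real.log 3 + Real.log M := Real.log_mul (by norm_num) hM0.ne'
      _ ≤ 2 + Real.log M := by
          have : Real.log 3 ≤ 3 - 1 := Real.log_le_sub_one_of_pos (by norm_num)
          linarith
  -- `(2 + log M)(1 + log M) ≤ (2 + √M)... `: use `log M ≤ 2 √M`? avoid: `log M ≤ M^{1/2}`... use
  -- `(log M)^2 ≤ M`: from `log M = 2 log √M ≤ 2 (√M - 1)`, so `(log M)^2 ≤ 4 M`.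
  have hsq : Real.log (M : ℝ) ^ 2 ≤ 4 * M := by
    have hs : Real.log (M : ℝ) = 2 * Real.log (Real.sqrt M) := by
      rw [Real.log_sqrt hM0.le]; ring
    have hs1 : Real.log (Real.sqrt M) ≤ Real.sqrt M - 1 :=
      Real.log_le_sub_one_of_pos (Real.sqrt_pos.2 hM0)
    have hs0 : 0 ≤ Real.log (Real.sqrt M) := Real.log_nonneg (by
      rw [Real.le_sqrt (by norm_num) hM0.le]; simpa using hM1)
    have hsqM : Real.sqrt (M : ℝ) ^ 2 = M := Real.sq_sqrt hM0.le
    rw [hs]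
    nlinarith
  have hT2 : 12 * ∑ ρ ∈ SchoenfeldBound.zerosBetween (0 : ℝ) (M : ℝ),
      (riemannZetaZeroOrder ρ : ℝ) * (1 / ρ.im) ≤ 192 * A₀ * M := by
    have := mul_le_mul_of_nonneg_left h2 (by norm_num : (0 : ℝ) ≤ 12)
    have hb : Real.log ((M : ℝ) + 2) * (2 * (1 + Real.log M)) ≤ 16 * M := by
      calc Real.log ((M : ℝ) + 2) * (2 * (1 + Real.log M))
          ≤ (2 + Real.log M) * (2 * (1 + Real.log M)) :=
            mul_le_mul_of_nonneg_right hlogM2' (by positivity)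
        _ = 4 + 6 * Real.log M + 2 * Real.log M ^ 2 := by ring
        _ ≤ 16 * M := by nlinarith
    have : A₀ * Real.log ((M : ℝ) + 2) * (2 * (1 + Real.log M)) ≤ A₀ * (16 * M) := by
      rw [mul_assoc]; exact mul_le_mul_of_nonneg_left hb hA00
    linarith
  have hT3 : 36 / (M : ℝ) * ∑ ρ ∈ SchoenfeldBound.zerosBetween (0 : ℝ) (M : ℝ),
      (riemannZetaZeroOrder ρ : ℝ) ≤ 72 * A₀ * M := by
    calc 36 / (M : ℝ) * ∑ ρ ∈ SchoenfeldBound.zerosBetween (0 : ℝ) (M : ℝ),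
        (riemannZetaZeroOrder ρ : ℝ) ≤ 36 / (M : ℝ) * (A₀ * Real.log (M + 2) * M) :=
          mul_le_mul_of_nonneg_left h3 (by positivity)
      _ = 36 * A₀ * Real.log (M + 2) := by field_simp
      _ ≤ 36 * A₀ * (2 * M) := by
          refine mul_le_mul_of_nonneg_left ?_ (by positivity)
          linarith
      _ = 72 * A₀ * M := by ring
  have hT1 : (M : ℝ) * ∑ ρ ∈ SchoenfeldBound.zerosBetween (0 : ℝ) (M : ℝ),
      (riemannZetaZeroOrder ρ : ℝ) / ρ.im ^ 2 ≤ 1 / 10 * M := by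
    have := mul_le_mul_of_nonneg_left h1 hM0.le
    linarith
  linarith

end Literature.NumberTheory.LFunctions
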